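import Summits.ResolutionOfSingularities.ResolutionOfSingularities.Theses.WildPurity
import Summits.ResolutionOfSingularities.ResolutionOfSingularities.Theorems.WildPurityPurityTransferDeRham
import Literature.NumberTheory.GaloisCohomology.KatoCohomologyPurityDeRham
import HarnessLib

/-!
# Crux `PurityTransfer` (stmt-ResolutionOfSingularities-17142) — line `birth`, lead c1 skeleton (rev L5)

State after lead c1's cycle 1 (2026-08-17): the crux is CLOSED MODULO ONE NAMED FACT, Gros–Suwa purity
ON DIFFERENTIAL FORMS, `Literature.NumberTheory.GaloisCohomology.GrosSuwa1988_purity_deRham`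
(`KatoCohomologyPurityDeRham.lean`, p164625) — the part of [GrosSuwa1988, Thm. 1.4] that needs the inverse
Cartier operator and the Cousin-complex argument on the local ring of a smooth scheme.  Everything else is
landed (all ACCEPTED):

* rev L4 stubs: `stub_formsSpan` p163554, `stub_bkForward` p163789, `stub_bkBackwardForms` p164746 (construction
  in `Literature/NumberTheory/GaloisCohomology/BlochKatoForms.lean` p164219 + `BlochKatoFormsSymbol.lean` p164495),
  `stub_bkDescends` p164190, `stub_bkAssemble` p164347, `stub_purityTransport` p163682;
* `BlochKato1986_symbolicPresentation_holds` p164838 — the tree's named fact `BlochKato1986_symbolicPresentation`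
  (Bloch–Kato 1986 Lemma (4.2): `KatoCohomologySymbolic ≃+ KatoCohomologyDeRham`) is now a THEOREM;
* `grosSuwa1988_purity_of_deRham : GrosSuwa1988_purity_deRham → GrosSuwa1988_purity` and
  `PurityTransfer_of_deRhamPurity : GrosSuwa1988_purity_deRham.{0} → PurityTransfer`
  (`Theorems/WildPurityPurityTransferDeRham.lean`, p165072), on top of lead 0's
  `PurityTransfer_of_grosSuwa1988` (p160398: valuative-criterion lift, regular chart inside `O`, Gersten purity
  at the centre, local domination; `R ⊆ O` load-bearing).

Exactly one theorem concludes the crux: `PurityTransfer_proof`.  One stub: `stub_deRhamPurity` (the fact).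
Disproof used (`Cruxes/PurityTransfer/Disproof.lean`, cdisprove c1 FINAL): `R ⊆ O` load-bearing — consumed
inside `PurityTransfer_of_grosSuwa1988`; `-- Targets`: none.
-/

noncomputable section

-- single-problem summit: the doubled namespace component `ResolutionOfSingularities` is forced
set_option linter.dupNamespace false

open Literature.NumberTheory.GaloisCohomology
open Summit.ResolutionOfSingularities.ResolutionOfSingularities.Theses.WildPurity (PurityTransfer)
open Summit.ResolutionOfSingularities.ResolutionOfSingularities.Theorems.WildPurityPurityTransfer
  (PurityTransfer_of_deRhamPurity)

universe u

namespace Summit.ResolutionOfSingularities.ResolutionOfSingularities.Cruxes.PurityTransfer.Lines.Birth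

/-- **STUB (XL; the named fact, de Rham side)** — Gersten purity for Kato's `H^{n+1}_p` at a point of a
smooth scheme over a perfect field, ON DIFFERENTIAL FORMS
(`Literature.NumberTheory.GaloisCohomology.GrosSuwa1988_purity_deRham`): for `k` perfect of characteristic
`p`, `B ⊆ K` a finitely generated affine model, `𝔮` a prime with `B_𝔮` regular, a class of
`KatoCohomologyDeRham p K n = Ωⁿ_K/(dΩⁿ⁻¹_K + ⟨(a^p − a) dlog b⟩)` generated by `(B_𝔮)_P`-integral logarithmic form
classes for every height-one prime `P` of `B_𝔮` is generated by `B_𝔮`-integral ones (Gros–Suwa 1988, Thm. 1.4;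
needs the inverse Cartier operator and the Cousin-complex argument — not in Mathlib; stays a named fact).
[cite: GrosSuwa1988, Thm. 1.4] -/
theorem stub_deRhamPurity : GrosSuwa1988_purity_deRham.{u} := by
  sorry

/-- **The crux `PurityTransfer`, assembled**: the landed composition `PurityTransfer_of_deRhamPurity`
(= `PurityTransfer_of_grosSuwa1988 ∘ stub_purityTransport BlochKato1986_symbolicPresentation_holds`) fed with
the one open stub. [cite: GrosSuwa1988, Thm. 1.4; BlochKato1986, Lemma (4.2); ZariskiSamuel1960, Ch. VI §14,
Thm. 31] -/
theorem PurityTransfer_proof : PurityTransfer :=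
  PurityTransfer_of_deRhamPurity stub_deRhamPurity.{0}

end Summit.ResolutionOfSingularities.ResolutionOfSingularities.Cruxes.PurityTransfer.Lines.Birth

end
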